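import Summits.SmoothPoincare4.SmoothPoincare4.Theorems.SymplecticOrigamiGromovRecognitionRelEndHelperNormalVelocityLocal
import Summits.SmoothPoincare4.SmoothPoincare4.Theorems.SymplecticOrigamiGromovRecognitionRelEndHelperNormalVelocitySmooth
import Summits.SmoothPoincare4.SmoothPoincare4.Theorems.SymplecticOrigamiGromovRecognitionRelEndHelperLeafSignConstant
import Summits.SmoothPoincare4.SmoothPoincare4.Theorems.SymplecticOrigamiGromovRecognitionRelEndHelperSphereFunctionIndexSum
import Summits.SmoothPoincare4.SmoothPoincare4.Theorems.SymplecticOrigamiGromovRecognitionRelEndHelperTwoChartZeroSetUnivOrFinite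
import Literature.Geometry.Symplectic.SphereIntersectionIndexHomologicalProofs

/-!
# The normal velocity dichotomy for families of `J`-spheres through an embedded sphere with trivial normal bundle
(registered helper `helper_normalVelocityDichotomy` of line `cross-cap-laurent`, crux `GromovRecognitionRelEnd`,
item stmt-SmoothPoincare4-11009; it is VERBATIM the birth stub `stub_normalVelocityDichotomy` of the split
piece `LocalFoliationEmbeddedSpheres`, child item stmt-SmoothPoincare4-16778 — C. Wendl, *Holomorphic
Curves in Low Dimensions* (2018), proof of Prop. 2.53 with Prop. 2.47 / §2.4–2.5: a section in the
kernel of the normal Cauchy–Riemann operator of an embedded `J`-sphere with `c₁(N) = 0` is identically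
zero or nowhere zero)

Setting: `S = (u₀, v₀)` an embedded `JX`-holomorphic two-chart sphere in a `4`-manifold, `(N, πN)` a
trivial-normal-bundle witness (`πN` a submersion on the open `N ⊇ S` with zero set `S`), `(U a, V a)`,
`‖a‖ < ε`, a jointly smooth family of `JX`-holomorphic two-chart spheres through `S`.  The NORMAL
VELOCITY in direction `c` has the two chart readings `σ z = ∂_c πN (U · z)|₀`, `σ' w = ∂_c πN (V · w)|₀`.

Claim: `(σ ≡ 0 ∧ σ' ≡ 0) ∨ (σ ≠ 0 everywhere ∧ σ' ≠ 0 everywhere)`.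

Proof (assembly of the registered helpers of this line).  `σ, σ'` are smooth with `σ' w = σ (w⁻¹)`
(`helper_normalVelocitySmooth`).  LOCALLY at a zero, in either chart, `σ` vanishes identically nearby
or has an isolated zero of signed index `s = ±1`, `s` the orientation sign of `dπN` relative to `JX` at
the point (`helper_normalVelocityLocal`: chart localisation + the linearised Cauchy–Riemann equation +
the similarity principle); this sign is the SAME at all points of the sphere
(`helper_leafSignConstant` along `u₀` and along `v₀`, matched at the common point `u₀ 1 = v₀ 1`).
GLOBALLY, the zero set of `σ` is therefore all of `ℂ` or finite
(`helper_twoChartZeroSetUnivOrFinite`); in the first case `σ' ≡ 0` too (continuity); in the second,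
the winding numbers of `σ, σ'` about all the zeros add up to ZERO (`helper_sphereFunctionIndexSum`: the
total index of a function on the sphere vanishes) while each is `s ·` (positive), so there are no zeros
at all.

References: C. Wendl, *Holomorphic Curves in Low Dimensions*, LNM 2216 (2018), Prop. 2.53, Prop. 2.47,
§2.4–2.5; H. Hofer, V. Lizan, J.-C. Sikorav, J. Geom. Anal. 7 (1997), Thm. 1.  No new definitions,
notation or instances.
-/

noncomputable section

open scoped Manifold ContDiff Topology
open Set Function Filter Metric Literature.Geometry.Symplectic Literature.Topology.PlaneTopology

-- the prescribed namespace `Summit.<P>.<Sub>.…` duplicates `SmoothPoincare4` (P = Sub)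
set_option linter.dupNamespace false

namespace Summit.SmoothPoincare4.SmoothPoincare4.Theorems.GromovRecognitionRelEnd.CrossCapLaurent

namespace NormalVelocityDichotomy

/-- Two signs `s, s' ∈ {1, -1}` making the same non-zero real number positive are equal.
[folklore] -/
theorem sign_eq_of_pos {s s' : ℤ} (hs : s = 1 ∨ s = -1) (hs' : s' = 1 ∨ s' = -1) {q : ℝ}
    (h : 0 < (s : ℝ) * q) (h' : 0 < (s' : ℝ) * q) : s = s' := by
  rcases hs with rfl | rfl <;> rcases hs' with rfl | rfl <;> first | rfl | (push_cast at h h'; nlinarith)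

/-- A punctured-disc non-vanishing statement is an `𝓝[≠]`-eventual one. [folklore] -/
theorem eventually_ne_of_punctured {f : ℂ → ℂ} {z₀ : ℂ} {r₀ : ℝ} (hr₀ : 0 < r₀)
    (h : ∀ z : ℂ, 0 < ‖z - z₀‖ → ‖z - z₀‖ ≤ r₀ → f z ≠ 0) : ∀ᶠ z in 𝓝[≠] z₀, f z ≠ 0 := by
  rw [eventually_nhdsWithin_iff, Metric.eventually_nhds_iff_ball]
  refine ⟨r₀, hr₀, fun z hz hne => h z ?_ ?_⟩
  · exact norm_pos_iff.2 (sub_ne_zero.2 hne)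
  · rw [mem_ball, dist_eq_norm] at hz; exact hz.le

/-- A function vanishing off the origin and continuous vanishes at the origin. [folklore] -/
theorem eq_zero_of_forall_ne {f : ℂ → ℂ} (hf : Continuous f) (h : ∀ w : ℂ, w ≠ 0 → f w = 0) (w : ℂ) :
    f w = 0 := by
  have hZ : IsClosed {w : ℂ | f w = 0} := isClosed_eq hf continuous_const
  have hsub : ({0}ᶜ : Set ℂ) ⊆ {w : ℂ | f w = 0} := fun w hw => h w hw
  have hd : Dense ({0}ᶜ : Set ℂ) := dense_compl_singleton 0
  have : (univ : Set ℂ) ⊆ {w : ℂ | f w = 0} := by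
    rw [← hd.closure_eq]
    exact hZ.closure_subset_iff.2 hsub
  exact this (mem_univ w)

end NormalVelocityDichotomy

open NormalVelocityDichotomy SphereZeroSetIndex TwoChartZeroSet in
/-- **Registered helper `helper_normalVelocityDichotomy` = the birth stub `stub_normalVelocityDichotomy`
of the split piece `LocalFoliationEmbeddedSpheres` (child item stmt-SmoothPoincare4-16778), verbatim**
(see the module docstring). [cite: Wendl2018, Prop. 2.53 and Prop. 2.47] -/
theorem helper_normalVelocityDichotomy : ∀ (X : Type) [TopologicalSpace X] [T2Space X] [SecondCountableTopology X] [ChartedSpace (EuclideanSpace ℝ (Fin 4)) X] [IsManifold (𝓡 4) ∞ X] (JX : Literature.Geometry.Symplectic.AlmostComplexStructure (𝓡 4) ∞ X) (u₀ v₀ : ℂ → X) (N : Set X) (πN : X → ℂ), ContMDiff 𝓘(ℝ, ℂ) (𝓡 4) ∞ u₀ → ContMDiff 𝓘(ℝ, ℂ) (𝓡 4) ∞ v₀ → (∀ z : ℂ, z ≠ 0 → v₀ z = u₀ z⁻¹) → Literature.Geometry.Symplectic.IsJHolomorphic (𝓡 4) (fun y => JX y) u₀ → Literature.Geometry.Symplectic.IsJHolomorphic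 (𝓡 4) (fun y => JX y) v₀ → Function.Injective u₀ → (∀ z, Function.Injective (mfderiv 𝓘(ℝ, ℂ) (𝓡 4) u₀ z)) → Function.Injective (mfderiv 𝓘(ℝ, ℂ) (𝓡 4) v₀ 0) → v₀ 0 ∉ Set.range u₀ → IsOpen N → Set.range u₀ ∪ {v₀ 0} ⊆ N → ContMDiffOn (𝓡 4) 𝓘(ℝ, ℂ) ∞ πN N → (∀ y ∈ N, Function.Surjective (mfderiv (𝓡 4) 𝓘(ℝ, ℂ) πN y)) → {y | y ∈ N ∧ πN y = 0} = Set.range u₀ ∪ {v₀ 0} → ∀ (ε : ℝ) (U V : ℂ → ℂ → X), 0 < ε → (∀ z, U 0 z = u₀ z) → (∀ w, V 0 w = v₀ w) → (∀ a : ℂ, ‖a‖ < ε → (∀ z : ℂ, z ≠ 0 → V a z = U a z⁻¹) ∧ Literature.Geometry.Symplectic.IsJHolomorphic (𝓡 4) (fun y => JX y) (U a) ∧ Literature.Geometry.Symplectic.IsJHolomorphic (𝓡 4) (fun y => JX y) (V a)) → ContMDiffOn 𝓘(ℝ, ℂ × ℂ) (𝓡 4) ∞ (fun q : ℂ × ℂ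 => U q.1 q.2) (Metric.ball 0 ε ×ˢ Set.univ) → ContMDiffOn 𝓘(ℝ, ℂ × ℂ) (𝓡 4) ∞ (fun q : ℂ × ℂ => V q.1 q.2) (Metric.ball 0 ε ×ˢ Set.univ) → ∀ c : ℂ, ((∀ z, (fderiv ℝ (fun a : ℂ => πN (U a z)) 0) c = 0) ∧ (∀ w, (fderiv ℝ (fun a : ℂ => πN (V a w)) 0) c = 0)) ∨ ((∀ z, (fderiv ℝ (fun a : ℂ => πN (U a z)) 0) c ≠ 0) ∧ (∀ w, (fderiv ℝ (fun a : ℂ => πN (V a w)) 0) c ≠ 0)) := by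
  intro X _ _ _ _ _ JX u₀ v₀ N πN hu₀ hv₀ huv₀ hJu₀ hJv₀ _hinj himm himm₀ _hnot hN hsub hπ hsurj hzero
    ε U V hε hU0 hV0 hfam hU hV c
  -- ### the two chart readings of the normal velocity
  set σU : ℂ → ℂ := fun z => fderiv ℝ (fun a : ℂ => πN (U a z)) 0 c with hσU
  set σV : ℂ → ℂ := fun w => fderiv ℝ (fun a : ℂ => πN (V a w)) 0 c with hσV
  obtain ⟨hσUs, hσVs, hrel, -, -⟩ := helper_normalVelocitySmooth X u₀ v₀ N πN ε U V hN hsub hπ hε hU0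
    hV0 (fun a ha z hz => (hfam a ha).1 z hz) hU hV c
  have hrel' : ∀ w : ℂ, w ≠ 0 → σV w = σU w⁻¹ := hrel
  have hrelU : ∀ z : ℂ, z ≠ 0 → σU z = σV z⁻¹ := fun z hz => by
    rw [hrel' _ (inv_ne_zero hz), inv_inv]
  -- ### the sphere lies in the zero set of `πN` inside `N`
  have hsphere : ∀ y ∈ range u₀ ∪ {v₀ 0}, y ∈ N ∧ πN y = 0 := fun y hy => by
    have : y ∈ {y | y ∈ N ∧ πN y = 0} := by rw [hzero]; exact hy
    exact this
  have hu₀N : ∀ z : ℂ, u₀ z ∈ N ∧ πN (u₀ z) = 0 := fun z => hsphere _ (Or.inl ⟨z, rfl⟩)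
  have hv₀mem : ∀ w : ℂ, v₀ w ∈ range u₀ ∪ {v₀ 0} := fun w => by
    by_cases hw : w = 0
    · rw [hw]; exact Or.inr rfl
    · rw [huv₀ w hw]; exact Or.inl ⟨w⁻¹, rfl⟩
  have hv₀N : ∀ w : ℂ, v₀ w ∈ N ∧ πN (v₀ w) = 0 := fun w => hsphere _ (hv₀mem w)
  have himmv : ∀ w : ℂ, Injective (mfderiv 𝓘(ℝ, ℂ) (𝓡 4) v₀ w) := fun w => by
    by_cases hw : w = 0
    · rw [hw]; exact himm₀
    · exact injective_mfderiv_snd hu₀ huv₀ hw (himm w⁻¹)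
  have hJU : ∀ a : ℂ, ‖a‖ < ε → IsJHolomorphic (𝓡 4) (fun y => JX y) (U a) := fun a ha => (hfam a ha).2.1
  have hJV : ∀ a : ℂ, ‖a‖ < ε → IsJHolomorphic (𝓡 4) (fun y => JX y) (V a) := fun a ha => (hfam a ha).2.2
  -- ### the local dichotomies
  have locU : ∀ z₁ : ℂ, σU z₁ = 0 → (∀ᶠ z in 𝓝 z₁, σU z = 0) ∨ ∃ (s : ℤ) (r₀ : ℝ), (s = 1 ∨ s = -1) ∧
      0 < r₀ ∧ (∀ V : TangentSpace (𝓡 4) (u₀ z₁), mfderiv (𝓡 4) 𝓘(ℝ, ℂ) πN (u₀ z₁) V ≠ 0 →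
        0 < (s : ℝ) * ((show ℂ from mfderiv (𝓡 4) 𝓘(ℝ, ℂ) πN (u₀ z₁) (JX (u₀ z₁) V)) *
          (starRingEnd ℂ) (show ℂ from mfderiv (𝓡 4) 𝓘(ℝ, ℂ) πN (u₀ z₁) V)).im) ∧
      (∀ z : ℂ, 0 < ‖z - z₁‖ → ‖z - z₁‖ ≤ r₀ → σU z ≠ 0) ∧
      (∀ r : ℝ, 0 < r → r ≤ r₀ → 0 < (s : ℤ) * wind (fun t : ℝ => σU (circleLoop z₁ r t))) :=
    fun z₁ h => helper_normalVelocityLocal X JX U u₀ N πN ε z₁ c hε hN hπ hu₀ hJu₀ (himm z₁)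
      (Eventually.of_forall hu₀N) (hsurj _ (hu₀N z₁).1) hU0 hJU hU h
  have locV : σV 0 = 0 → (∀ᶠ w in 𝓝 (0 : ℂ), σV w = 0) ∨ ∃ (s : ℤ) (r₀ : ℝ), (s = 1 ∨ s = -1) ∧
      0 < r₀ ∧ (∀ V : TangentSpace (𝓡 4) (v₀ 0), mfderiv (𝓡 4) 𝓘(ℝ, ℂ) πN (v₀ 0) V ≠ 0 →
        0 < (s : ℝ) * ((show ℂ from mfderiv (𝓡 4) 𝓘(ℝ, ℂ) πN (v₀ 0) (JX (v₀ 0) V)) *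
          (starRingEnd ℂ) (show ℂ from mfderiv (𝓡 4) 𝓘(ℝ, ℂ) πN (v₀ 0) V)).im) ∧
      (∀ w : ℂ, 0 < ‖w - 0‖ → ‖w - 0‖ ≤ r₀ → σV w ≠ 0) ∧
      (∀ r : ℝ, 0 < r → r ≤ r₀ → 0 < (s : ℤ) * wind (fun t : ℝ => σV (circleLoop 0 r t))) :=
    fun h => helper_normalVelocityLocal X JX V v₀ N πN ε 0 c hε hN hπ hv₀ hJv₀ (himmv 0)
      (Eventually.of_forall hv₀N) (hsurj _ (hv₀N 0).1) hV0 hJV hV h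
  -- ### the global sign
  obtain ⟨s, hs, hsign⟩ : ∃ s : ℤ, (s = 1 ∨ s = -1) ∧ ∀ y ∈ range u₀ ∪ {v₀ 0},
      ∀ V : TangentSpace (𝓡 4) y, mfderiv (𝓡 4) 𝓘(ℝ, ℂ) πN y V ≠ 0 →
        0 < (s : ℝ) * ((show ℂ from mfderiv (𝓡 4) 𝓘(ℝ, ℂ) πN y (JX y V)) *
          (starRingEnd ℂ) (show ℂ from mfderiv (𝓡 4) 𝓘(ℝ, ℂ) πN y V)).im := by
    have signU := helper_leafSignConstant X JX u₀ N πN hN hπ hu₀ hJu₀ himm hu₀N fun z => hsurj _ (hu₀N z).1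
    have signV := helper_leafSignConstant X JX v₀ N πN hN hπ hv₀ hJv₀ himmv hv₀N fun w => hsurj _ (hv₀N w).1
    -- the common point `u₀ 1 = v₀ 1` forces the two curves to have the same sign
    have h1 : v₀ 1 = u₀ 1 := by rw [huv₀ 1 one_ne_zero, inv_one]
    obtain ⟨V₁, hV₁⟩ := hsurj _ (hu₀N 1).1 (show TangentSpace 𝓘(ℝ, ℂ) (πN (u₀ 1)) from (1 : ℂ))
    have hV₁ne : mfderiv (𝓡 4) 𝓘(ℝ, ℂ) πN (u₀ 1) V₁ ≠ 0 := fun h0 =>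
      one_ne_zero (α := ℂ) (hV₁.symm.trans h0)
    -- transport of a statement at `v₀ 1` to `u₀ 1`
    have transport : ∀ (P : X → Prop), P (v₀ 1) → P (u₀ 1) := fun P hP => h1 ▸ hP
    rcases signU with hUp | hUn
    · refine ⟨1, Or.inl rfl, ?_⟩
      rintro y (⟨z, rfl⟩ | hy) V hV
      · rw [Int.cast_one, one_mul]; exact hUp z V hV
      · rw [mem_singleton_iff] at hy
        subst hy
        rw [Int.cast_one, one_mul]
        rcases signV with hVp | hVn
        · exact hVp 0 V hV
        · exfalso
          have hneg := transport (fun y => ∀ V : TangentSpace (𝓡 4) y, mfderiv (𝓡 4) 𝓘(ℝ, ℂ) πN y V ≠ 0 →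
            ((show ℂ from mfderiv (𝓡 4) 𝓘(ℝ, ℂ) πN y (JX y V)) *
              (starRingEnd ℂ) (show ℂ from mfderiv (𝓡 4) 𝓘(ℝ, ℂ) πN y V)).im < 0) (hVn 1) V₁ hV₁ne
          exact absurd (hUp 1 V₁ hV₁ne) (not_lt.2 hneg.le)
    · refine ⟨-1, Or.inr rfl, ?_⟩
      rintro y (⟨z, rfl⟩ | hy) V hV
      · rw [Int.cast_neg, Int.cast_one, neg_mul, one_mul, neg_pos]; exact hUn z V hV
      · rw [mem_singleton_iff] at hy
        subst hy
        rw [Int.cast_neg, Int.cast_one, neg_mul, one_mul, neg_pos]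
        rcases signV with hVp | hVn
        · exfalso
          have hpos := transport (fun y => ∀ V : TangentSpace (𝓡 4) y, mfderiv (𝓡 4) 𝓘(ℝ, ℂ) πN y V ≠ 0 →
            0 < ((show ℂ from mfderiv (𝓡 4) 𝓘(ℝ, ℂ) πN y (JX y V)) *
              (starRingEnd ℂ) (show ℂ from mfderiv (𝓡 4) 𝓘(ℝ, ℂ) πN y V)).im) (hVp 1) V₁ hV₁ne
          exact absurd hpos (not_lt.2 (hUn 1 V₁ hV₁ne).le)
        · exact hVn 0 V hV
  -- ### the zero set of `σU` is all of `ℂ` or finite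
  have keyU : ∀ z₀ : ℂ, σU z₀ = 0 → (∀ᶠ z in 𝓝 z₀, σU z = 0) ∨ (∀ᶠ z in 𝓝[≠] z₀, σU z ≠ 0) := by
    intro z₀ h
    rcases locU z₀ h with h | ⟨s', r₀, -, hr₀, -, hne, -⟩
    · exact Or.inl h
    · exact Or.inr (eventually_ne_of_punctured hr₀ hne)
  have keyV : σV 0 = 0 → (∀ᶠ w in 𝓝 (0 : ℂ), σV w = 0) ∨ (∀ᶠ w in 𝓝[≠] (0 : ℂ), σV w ≠ 0) := by
    intro h
    rcases locV h with h | ⟨s', r₀, -, hr₀, -, hne, -⟩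
    · exact Or.inl h
    · exact Or.inr (eventually_ne_of_punctured hr₀ hne)
  rcases helper_twoChartZeroSetUnivOrFinite σU σV hσUs.continuous hσVs.continuous hrel' keyU keyV with
    hall | hfin
  · -- ### everything vanishes
    left
    have hU0' : ∀ z : ℂ, σU z = 0 := fun z => by
      have : z ∈ {z : ℂ | σU z = 0} := by rw [hall]; exact mem_univ z
      exact this
    refine ⟨hU0', eq_zero_of_forall_ne hσVs.continuous fun w hw => ?_⟩
    show σV w = 0
    rw [hrel' w hw]
    exact hU0' _
  -- ### finitely many zeros: count indices
  right
  set S : Set ℂ := {z : ℂ | σU z = 0} with hS_def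
  -- every zero of `σU` is isolated with index of sign `s`
  have isoU : ∀ z₁ ∈ S, ∃ r₀ : ℝ, 0 < r₀ ∧ (∀ z : ℂ, 0 < ‖z - z₁‖ → ‖z - z₁‖ ≤ r₀ → σU z ≠ 0) ∧
      ∀ r : ℝ, 0 < r → r ≤ r₀ → 0 < (s : ℤ) * wind (fun t : ℝ => σU (circleLoop z₁ r t)) := by
    intro z₁ hz₁
    rcases locU z₁ hz₁ with h | ⟨s', r₀, hs', hr₀, hsgn, hne, hwind⟩
    · exfalso
      obtain ⟨δ, hδ, hball⟩ := Metric.eventually_nhds_iff_ball.1 h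
      exact (infinite_of_ball_subset hδ fun z hz => hball z hz) hfin
    · obtain ⟨V₀, hV₀⟩ := hsurj _ (hu₀N z₁).1 (show TangentSpace 𝓘(ℝ, ℂ) (πN (u₀ z₁)) from (1 : ℂ))
      have hV₀ne : mfderiv (𝓡 4) 𝓘(ℝ, ℂ) πN (u₀ z₁) V₀ ≠ 0 := fun h0 =>
        one_ne_zero (α := ℂ) (hV₀.symm.trans h0)
      have hss' : s' = s := sign_eq_of_pos hs' hs (hsgn V₀ hV₀ne) (hsign _ (Or.inl ⟨z₁, rfl⟩) V₀ hV₀ne)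
      subst hss'
      exact ⟨r₀, hr₀, hne, hwind⟩
  -- the same for `σV` at `0`, if it vanishes there
  have isoV : σV 0 = 0 → ∃ r₀ : ℝ, 0 < r₀ ∧ (∀ w : ℂ, 0 < ‖w‖ → ‖w‖ ≤ r₀ → σV w ≠ 0) ∧
      ∀ r : ℝ, 0 < r → r ≤ r₀ → 0 < (s : ℤ) * wind (fun t : ℝ => σV (circleLoop 0 r t)) := by
    intro h0
    rcases locV h0 with h | ⟨s', r₀, hs', hr₀, hsgn, hne, hwind⟩
    · exfalso
      obtain ⟨δ, hδ, hball⟩ := Metric.eventually_nhds_iff_ball.1 h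
      -- then `σU` vanishes outside the disc of radius `δ⁻¹`: infinitely many zeros
      refine (infinite_of_ball_subset (z₀ := ((2 * δ⁻¹ : ℝ) : ℂ)) (inv_pos.2 hδ) (fun z hz => ?_)) hfin
      have hzn : δ⁻¹ < ‖z‖ := by
        rw [mem_ball, dist_eq_norm] at hz
        have h1 : ‖((2 * δ⁻¹ : ℝ) : ℂ)‖ = 2 * δ⁻¹ := by
          rw [Complex.norm_real, Real.norm_eq_abs, abs_of_pos (by positivity)]
        have h2 := norm_sub_norm_le ((2 * δ⁻¹ : ℝ) : ℂ) z
        rw [h1, norm_sub_rev] at h2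
        linarith
      have hzpos : 0 < ‖z‖ := lt_trans (inv_pos.2 hδ) hzn
      have hz0 : z ≠ 0 := norm_pos_iff.1 hzpos
      show σU z = 0
      rw [hrelU z hz0]
      apply hball
      rw [mem_ball, dist_zero_right, norm_inv]
      exact inv_lt_of_inv_lt₀ hδ hzn
    · obtain ⟨V₀, hV₀⟩ := hsurj _ (hv₀N 0).1 (show TangentSpace 𝓘(ℝ, ℂ) (πN (v₀ 0)) from (1 : ℂ))
      have hV₀ne : mfderiv (𝓡 4) 𝓘(ℝ, ℂ) πN (v₀ 0) V₀ ≠ 0 := fun h0 =>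
        one_ne_zero (α := ℂ) (hV₀.symm.trans h0)
      have hss' : s' = s := sign_eq_of_pos hs' hs (hsgn V₀ hV₀ne) (hsign _ (Or.inr rfl) V₀ hV₀ne)
      subst hss'
      exact ⟨r₀, hr₀, fun w hw hw' => hne w (by simpa using hw) (by simpa using hw'), hwind⟩
  -- the total index vanishes
  obtain ⟨ρ₀, hρ₀, hsum⟩ := helper_sphereFunctionIndexSum σU σV hσUs hσVs hrel' hfin
  -- a radius below all the local radii
  haveI : Fintype S := hfin.fintype
  choose rU hrU hneU hwU using isoU
  obtain ⟨ρ₁, hρ₁, hρ₁lt⟩ := exists_pos_lt_forall (fun z : S => rU z.1 z.2) fun z => hrU z.1 z.2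
  -- ### no zeros at all
  have main : S = ∅ ∧ σV 0 ≠ 0 := by
    by_contra hcon
    -- the radius, also below the `σV`-radius when `σV 0 = 0`
    obtain ⟨r, hr, hrρ₀, hrρ₁, hrV⟩ : ∃ r : ℝ, 0 < r ∧ r ≤ ρ₀ ∧ r < ρ₁ ∧
        (∀ h0 : σV 0 = 0, r ≤ Classical.choose (isoV h0)) := by
      by_cases h0 : σV 0 = 0
      · obtain ⟨hrV, -, -⟩ := Classical.choose_spec (isoV h0)
        refine ⟨min (min ρ₀ (ρ₁ / 2)) (Classical.choose (isoV h0)), lt_min (lt_min hρ₀ (by positivity)) hrV,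
          (min_le_left _ _).trans (min_le_left _ _),
          lt_of_le_of_lt ((min_le_left _ _).trans (min_le_right _ _)) (by linarith), fun h0' => ?_⟩
        exact min_le_right _ _
      · exact ⟨min ρ₀ (ρ₁ / 2), lt_min hρ₀ (by positivity), min_le_left _ _,
          lt_of_le_of_lt (min_le_right _ _) (by linarith), fun h0' => absurd h0' h0⟩
    have htot := hsum r hr hrρ₀
    -- the `σU`-terms are all `s`-positive
    have hUterms : ∀ z ∈ hfin.toFinset, 0 < (s : ℤ) * wind (fun t : ℝ => σU (circleLoop z r t)) := by
      intro z hz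
      have hzS : z ∈ S := hfin.mem_toFinset.1 hz
      exact hwU z hzS r hr (hrρ₁.le.trans (hρ₁lt ⟨z, hzS⟩).le)
    -- the `σV`-term
    set T : Set ℂ := {w : ℂ | w = 0 ∧ σV w = 0} with hT_def
    have hTfin : T.Finite := (Set.finite_singleton (0 : ℂ)).subset fun w hw => hw.1
    have hVterms : ∀ w ∈ hTfin.toFinset, 0 < (s : ℤ) * wind (fun t : ℝ => σV (circleLoop w r t)) := by
      intro w hw
      obtain ⟨hw0, hσ0⟩ := hTfin.mem_toFinset.1 hw
      subst hw0
      obtain ⟨-, -, hwind⟩ := Classical.choose_spec (isoV hσ0)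
      exact hwind r hr (hrV hσ0)
    rw [finsum_mem_eq_finite_toFinset_sum _ hfin, finsum_mem_eq_finite_toFinset_sum _ hTfin] at htot
    have hsplit : (s : ℤ) * ((∑ z ∈ hfin.toFinset, wind fun t : ℝ => σU (circleLoop z r t)) +
        ∑ w ∈ hTfin.toFinset, wind fun t : ℝ => σV (circleLoop w r t)) =
        (∑ z ∈ hfin.toFinset, (s : ℤ) * wind fun t : ℝ => σU (circleLoop z r t)) +
          ∑ w ∈ hTfin.toFinset, (s : ℤ) * wind fun t : ℝ => σV (circleLoop w r t) := by
      rw [mul_add, Finset.mul_sum, Finset.mul_sum]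
    have hzero' : (s : ℤ) * ((∑ z ∈ hfin.toFinset, wind fun t : ℝ => σU (circleLoop z r t)) +
        ∑ w ∈ hTfin.toFinset, wind fun t : ℝ => σV (circleLoop w r t)) = 0 := by
      rw [htot, mul_zero]
    rw [hsplit] at hzero'
    have hUnn : 0 ≤ ∑ z ∈ hfin.toFinset, (s : ℤ) * wind fun t : ℝ => σU (circleLoop z r t) :=
      Finset.sum_nonneg fun z hz => (hUterms z hz).le
    have hVnn : 0 ≤ ∑ w ∈ hTfin.toFinset, (s : ℤ) * wind fun t : ℝ => σV (circleLoop w r t) :=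
      Finset.sum_nonneg fun w hw => (hVterms w hw).le
    -- one of the two index sets is non-empty
    rcases not_and_or.1 hcon with hSne | hV0
    · have hne : hfin.toFinset.Nonempty := by
        rw [Set.Finite.toFinset_nonempty]
        exact nonempty_iff_ne_empty.2 hSne
      have hpos : 0 < ∑ z ∈ hfin.toFinset, (s : ℤ) * wind fun t : ℝ => σU (circleLoop z r t) :=
        Finset.sum_pos hUterms hne
      linarith
    · have h0 : σV 0 = 0 := not_not.1 hV0
      have hne : hTfin.toFinset.Nonempty := ⟨0, hTfin.mem_toFinset.2 ⟨rfl, h0⟩⟩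
      have hpos : 0 < ∑ w ∈ hTfin.toFinset, (s : ℤ) * wind fun t : ℝ => σV (circleLoop w r t) :=
        Finset.sum_pos hVterms hne
      linarith
  obtain ⟨hSempty, hV0⟩ := main
  refine ⟨fun z hz => ?_, fun w => ?_⟩
  · have : z ∈ S := hz
    rw [hSempty] at this
    exact this
  · by_cases hw : w = 0
    · rw [hw]; exact hV0
    · show σV w ≠ 0
      rw [hrel' w hw]
      intro hz
      have : w⁻¹ ∈ S := hz
      rw [hSempty] at this
      exact this

end Summit.SmoothPoincare4.SmoothPoincare4.Theorems.GromovRecognitionRelEnd.CrossCapLaurent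

end
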